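import Summits.ABC.ABC.Theorems.IUTThetaPilotABCOfCor312
import Summits.ABC.ABC.Theorems.IUTThetaPilotThetaPartIIOfCor312PerImage
import Summits.ABC.IUTFork.LDHGenuinePerImageSufficiencyPoint
import HarnessLib

set_option linter.dupNamespace false

/-!
# Route `route-ABC-IUTThetaPilot`, crux `ThetaPartII` (stmt-ABC-19678), display-P line: the registered stub
# `stub_cor312PerImage` REDUCES to its SZPIRO-BAD sub-case — below the Szpiro threshold the (P)-line crux is a theorem

Proof-only companion (cell abc-iut, WAVE-3 discharge seat abc-iut-c312-d1, gen 7; row «P-CRUX-SUFFICIENCY»;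
`--supports stmt-ABC-19678`). The display-P composition of the registered RESHAPE-3 skeleton (abc-iut-c312-8, sha16 0bf3ba3d;
capstones abc-iut-S2 `ThetaPartII_of_cor312PerImage` / `ABC_of_cor312PerImage`) needs ONE open stub:

  `stub_cor312PerImage : ∀ P ∈ UP, ∀ l, l.Prime → 5 ≤ l → AdmitsCore P → CondP2 P l → CondP5 P l → CondP6 P l → Cor22.Cor312PerImageAtDatum P l`

— [IUTchIII] Cor. 3.12 read per image at the Θ-data of every admissible `λ`-line point [claim: Mochizuki2012, status: disputed].
By this seat's `Cor22.cor312PerImageAtDatum_of_szpiro` (`LDHGenuinePerImageSufficiencyPoint`, p446147: the per-image hull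
realises the different gain, abc-iut-w6-d018/S4's sharp lower window, [IUTchIV] Thm. 1.10 Steps (ii)/(v)) the conclusion is a
THEOREM at every `(P, l)` with `d_mod ≤ (l+5)/4` and
`log q^{∤2l}(λ) ≤ (6l(l+5−4d_mod)/((l+4)(l−3)))·(log-diff(λ) + (1 − 1/l)·log 𝔣^{∤2l}(λ)) + (6l(l+5)/((l+4)(l−3)))·log π`
(Szpiro constant `↓ 6`). Hence:

* `stub_cor312PerImage_of_szpiroBad` — the registered stub FOLLOWS from its restriction to the SZPIRO-BAD admissible points
  (`(l+5)/4 < d_mod`, or `log q^{∤2l}` ABOVE the threshold);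
* `ThetaPartII_of_cor312PerImage_szpiroBad`, **`ABC_of_cor312PerImage_szpiroBad`** — so `ThetaPartII`, and `ABC`, follow from
  [IUTchIII] Cor. 3.12 (per image) at the Θ-data of the Szpiro-bad admissible `λ`-line points ALONE (abc-iut-S2's capstones).

READING (statement about OUR typed objects; no side): the content of the display-P line of the crux sits exactly at the points whose
Szpiro ratio `log q^{∤2l}/(log-diff + (1−1/l)·log-cond^{∤2l})` exceeds `≈ 6(1 − O(1/l))` — the locus abc itself is about; everywhere
else the disputed inequality (as typed, per image) holds in the kernel. Offered to the route owner / skeleton holder as the bytes of a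
possible contentful cut; NOT a reshape (the skeleton of record is unchanged). Nothing here asserts Cor. 3.12, `ThetaPartII` or abc.
[cite: Mochizuki2012, IUTchIII Cor. 3.12 p. 173–174; IUTchIV Thm. 1.10 p. 22–23, Cor. 2.2 (ii) proof p. 46]
-/

noncomputable section

namespace Summit.ABC.ABC.Theorems

open Literature.NumberTheory.DiophantineGeometry.GenEll Literature.IUT.LogVolume

/-- **The registered (P)-line stub reduces to its Szpiro-bad sub-case.** If [IUTchIII] Cor. 3.12 (per image) holds at the
Θ-data of every ADMISSIBLE `λ`-line point `(P, l)` that is SZPIRO-BAD — `(l+5)/4 < d_mod`, or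
`(6l(l+5−4d_mod)/((l+4)(l−3)))·(log-diff + (1 − 1/l)·log-cond^{∤2l}) + (6l(l+5)/((l+4)(l−3)))·log π < log q^{∤2l}(λ)` — then it holds at
the Θ-data of EVERY admissible point (the Szpiro-good ones are covered by `Cor22.cor312PerImageAtDatum_of_szpiro`, p446147).
[claim: Mochizuki2012, status: disputed] [cite: Mochizuki2012, IUTchIII Cor. 3.12 p. 173–174; IUTchIV Cor. 2.2 (ii) proof p. 46] -/
theorem stub_cor312PerImage_of_szpiroBad
    (hbad : ∀ P : NFPoint, P ∈ UP → ∀ l : ℕ, l.Prime → 5 ≤ l →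
      Cor22.AdmitsCore P → Cor22.CondP2 P l → Cor22.CondP5 P l → Cor22.CondP6 P l →
      (((l : ℝ) + 5) / 4 < (Cor22.dmod P : ℝ) ∨
        6 * l * (((l : ℝ) + 5) - 4 * Cor22.dmod P) / (((l : ℝ) + 4) * ((l : ℝ) - 3))
            * (P.logDiff + (1 - 1 / (l : ℝ)) * Cor22.logCondAvoid P {2, l})
          + 6 * l * ((l : ℝ) + 5) / (((l : ℝ) + 4) * ((l : ℝ) - 3)) * Real.log Real.pi <
          Cor22.logQAvoid P {2, l}) →
      Cor22.Cor312PerImageAtDatum P l) :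
    ∀ P : NFPoint, P ∈ UP → ∀ l : ℕ, l.Prime → 5 ≤ l →
      Cor22.AdmitsCore P → Cor22.CondP2 P l → Cor22.CondP5 P l → Cor22.CondP6 P l →
        Cor22.Cor312PerImageAtDatum P l := by
  intro P hP l hl h5 hc h2 h5' h6
  by_cases hd : (Cor22.dmod P : ℝ) ≤ ((l : ℝ) + 5) / 4
  · by_cases hq : Cor22.logQAvoid P {2, l} ≤
        6 * l * (((l : ℝ) + 5) - 4 * Cor22.dmod P) / (((l : ℝ) + 4) * ((l : ℝ) - 3))
            * (P.logDiff + (1 - 1 / (l : ℝ)) * Cor22.logCondAvoid P {2, l})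
          + 6 * l * ((l : ℝ) + 5) / (((l : ℝ) + 4) * ((l : ℝ) - 3)) * Real.log Real.pi
    · exact Cor22.cor312PerImageAtDatum_of_szpiro hP.1 h5 hd hq
    · exact hbad P hP l hl h5 hc h2 h5' h6 (Or.inr (lt_of_not_ge hq))
  · exact hbad P hP l hl h5 hc h2 h5' h6 (Or.inl (lt_of_not_ge hd))

/-- **`ThetaPartII` from [IUTchIII] Cor. 3.12 (per image) at the Θ-data of the SZPIRO-BAD admissible `λ`-line points alone**
(abc-iut-S2's `ThetaPartII_of_cor312PerImage` ∘ `stub_cor312PerImage_of_szpiroBad`). CONDITIONAL; nothing asserted.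
[claim: Mochizuki2012, status: disputed] [cite: Mochizuki2012, IUTchIV Cor. 2.2 (ii) p. 41–46] -/
theorem ThetaPartII_of_cor312PerImage_szpiroBad
    (hbad : ∀ P : NFPoint, P ∈ UP → ∀ l : ℕ, l.Prime → 5 ≤ l →
      Cor22.AdmitsCore P → Cor22.CondP2 P l → Cor22.CondP5 P l → Cor22.CondP6 P l →
      (((l : ℝ) + 5) / 4 < (Cor22.dmod P : ℝ) ∨
        6 * l * (((l : ℝ) + 5) - 4 * Cor22.dmod P) / (((l : ℝ) + 4) * ((l : ℝ) - 3))
            * (P.logDiff + (1 - 1 / (l : ℝ)) * Cor22.logCondAvoid P {2, l})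
          + 6 * l * ((l : ℝ) + 5) / (((l : ℝ) + 4) * ((l : ℝ) - 3)) * Real.log Real.pi <
          Cor22.logQAvoid P {2, l}) →
      Cor22.Cor312PerImageAtDatum P l) :
    Summit.ABC.ABC.Theses.IUTThetaPilot.ThetaPartII :=
  ThetaPartII_of_cor312PerImage (stub_cor312PerImage_of_szpiroBad hbad)

/-- **`ABC` from [IUTchIII] Cor. 3.12 (per image) at the Θ-data of the SZPIRO-BAD admissible `λ`-line points alone** — every
other link of the IUT route's display-P line is a theorem of the tree (abc-iut-S2's `ABC_of_cor312PerImage`: [GenEll] Thm. 2.1 at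
`Σ = {2}` `genEllTwo_holds`, the WLOG on `j`, [IUTchIV] Cor. 2.2 Parts (i)/(iii), (ii′-P) `stub_hullVolumePerImage`, (P7)
`stub_thetaData`), and the Szpiro-good points are covered by p446147. CONDITIONAL on the displayed hypothesis; nothing here asserts abc.
[claim: Mochizuki2012, status: disputed] [cite: Mochizuki2012, IUTchIII Cor. 3.12 p. 173–174; IUTchIV Thm. A] -/
theorem ABC_of_cor312PerImage_szpiroBad
    (hbad : ∀ P : NFPoint, P ∈ UP → ∀ l : ℕ, l.Prime → 5 ≤ l →
      Cor22.AdmitsCore P → Cor22.CondP2 P l → Cor22.CondP5 P l → Cor22.CondP6 P l →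
      (((l : ℝ) + 5) / 4 < (Cor22.dmod P : ℝ) ∨
        6 * l * (((l : ℝ) + 5) - 4 * Cor22.dmod P) / (((l : ℝ) + 4) * ((l : ℝ) - 3))
            * (P.logDiff + (1 - 1 / (l : ℝ)) * Cor22.logCondAvoid P {2, l})
          + 6 * l * ((l : ℝ) + 5) / (((l : ℝ) + 4) * ((l : ℝ) - 3)) * Real.log Real.pi <
          Cor22.logQAvoid P {2, l}) →
      Cor22.Cor312PerImageAtDatum P l) :
    _root_.ABC :=
  ABC_of_cor312PerImage (stub_cor312PerImage_of_szpiroBad hbad)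

end Summit.ABC.ABC.Theorems

end
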